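import Summits.BirchSwinnertonDyer.Rank1Residual.X10.CoreTheoremAOddPrime
import Summits.BirchSwinnertonDyer.BirchSwinnertonDyer.Theorems.SmallImageMuTransferMuTransferX9CoreAssemblyOdd
import HarnessLib

/-!
# N2 (class X10b, `p = 3`) — the typed core `CoreTheoremAOddPrime` and the node `KatoMuTransferThree` FROM THE
# TWO OPEN STUBS of rung K6's crux `MuTransferX9` (skeleton v6, class-free) and published facts: the N2 closure
# is pre-wired to the K6 cell's assembly (cell `b2b-bsdres`, unit `b2b-bsdres-x10` = N2 class lead, GEN 38;
# theorems only; nothing asserted, nothing booked)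

HONEST FRAMING (run/shared/lean/b2b/bsd-rank1-residual/, verbatim in every file): the goal of the
cell is to DELETE the COMBINATION-SHAPED residual classes of the Birch–Swinnerton-Dyer formula for
ALL analytic-rank `≤ 1` elliptic curves over `ℚ` — "full BSD formula for every rank `≤ 1` curve in
class `C`" assembled STRICTLY from published theorems — so that the rank-`≤ 1` remainder becomes
exactly the CONSTRUCTION-SHAPED classes, which are TYPED (missing-input `Prop`s), NOT attempted.
This is not "finishing BSD". Class X10b (N2) keeps its label CONSTRUCTION-SHAPED / NEEDS X_A3
(RESIDUAL-MAP §I N2); nothing is booked by this file; no census number moves.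

## What (x10 GEN 38, X10-AUDIT §44)

GEN 37 typed the core ONCE for every odd prime (`X10.CoreTheoremAOddPrime`, p441660) and asked the K6 cell
(`bsd-smallim`) to state the composition of its deciding crux `MuTransferX9` (stmt-BirchSwinnertonDyer-19276)
class-free. The cell did: skeleton v6 (sha16 a90a661b046bb403, seat `bsd-smallim-k6-c2` g3, 2026-08-26T14:27Z)
carries the two OPEN stubs `stub_selmerDualOdd` (the Selmer-side dual class, MU-TRANSFER-PROOF STEP 1 input)
and `stub_stepsTwoFourOdd` (Lemma 2 + STEP 3 + STEP 4: the Kolyvagin class at the Chebotarev prime fed into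
Poitou–Tate reciprocity — whose STEP 4 half is x10's `Theorems/…X9StepFour*` series) with hypotheses
`p ≠ 2`, `E[p]` irreducible, `ρ̄` not onto, and its KERNEL composition
`CoreAssembly.coreOdd_of_selmerDual_of_stepsTwoFour` (p452034, `…X9CoreAssemblyOdd`) concludes — from the two
stubs and three published facts (`Kato2004.mem_pSmul_of_red_eq_zero` §13.8, `poitouTate_sum_localTatePairing_eq_zero ℚ`,
`localEulerPoincareCharacteristic` at every finite place) — EXACTLY the body of `CoreTheoremAOddPrime`.
THIS FILE is the one-line wiring of record:

* `coreTheoremAOddPrime_of_stubs` — facts + the two stub statements (VERBATIM, as hypotheses) ⟹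
  `CoreTheoremAOddPrime`; the GEN 36/37 chain (`coreTheoremAOnClassX10b_of_oddPrime`,
  `katoMuTransferThree_of_coreOddPrime` — N2's `μ`-transfer node modulo Kato's two construction facts —,
  `mazurMainConjectureOnClassX10b_of_coreOddPrime`, `bsdpOnClassX10b_of_coreOddPrime` — the A5 class leaf,
  Yan–Zhu 4.9 flagged, barrier B3 = `AnalyticMuZeroOnClassX10b` a hypothesis) then applies verbatim.

So the day the K6 cell lands `stub_selmerDualOdd` and `stub_stepsTwoFourOdd` (for every odd `p`, as stated),
rung K6's crux for class X9 (A4, via `stub_coreX9_of_selmerDualOdd_of_stepsTwoFourOdd`) AND N2's core for class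
X10b (A5, via this file) close by the same two terms — no `p = 3` twin of any proof is needed. Nothing here
is asserted: every open statement enters as a hypothesis.

References: X10-AUDIT.md §42–§44; HOME pub/bsd-smallim/STATUS.md «SKELETON v6 REGISTERED» (14:27Z);
K. Kato, Astérisque 295 (2004) Thm. 12.6, §13.8, §17.13 [Kato2004Asterisque]; B. Mazur, K. Rubin, Mem. AMS
799 (2004) [MazurRubin2004]; J. S. Milne, *ADT* (2006) I 2.8, 4.10 [MilneADT2006].
-/

set_option autoImplicit false

noncomputable section

open scoped Classical NumberField
open WeierstrassCurve Field IsDedekindDomain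
open Literature.NumberTheory.GaloisRepresentations
open Literature.NumberTheory.GaloisCohomology
open Literature.NumberTheory.EllipticCurves
open Literature.NumberTheory.EllipticCurves.Kato2004
open Literature.NumberTheory.EllipticCurves.Kato2004.EulerSystemValues
open Literature.NumberTheory.EllipticCurves.Rank1Residual
open Summit.BirchSwinnertonDyer.BirchSwinnertonDyer.Theorems.Rank1ResidualX1Defs
  Summit.BirchSwinnertonDyer.BirchSwinnertonDyer.Rank1Residual

namespace Summit.BirchSwinnertonDyer.Rank1Residual.X10

/-- **N2's typed core from skeleton v6's two open stubs and three published facts.** `hred`: Kato §13.8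
(`Kato2004.mem_pSmul_of_red_eq_zero`); `hPT`: Poitou–Tate over `ℚ`; `hEP`: the local Euler–Poincaré
characteristic at every finite place; `hG1` = `stub_selmerDualOdd` VERBATIM; `hG34` = `stub_stepsTwoFourOdd`
VERBATIM (skeleton v6 of crux 19276). Conclusion: `CoreTheoremAOddPrime` (GEN 37), by the K6 cell's kernel
composition `CoreAssembly.coreOdd_of_selmerDual_of_stepsTwoFour`. Nothing asserted.
[cite: Kato2004Asterisque, §13.8 and Thm. 12.6 (p. 222)] [cite: MilneADT2006, Ch. I, Thm. 4.10(b)] -/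
theorem coreTheoremAOddPrime_of_stubs (hred : mem_pSmul_of_red_eq_zero)
    (hPT : poitouTate_sum_localTatePairing_eq_zero ℚ)
    (hEP : ∀ v : HeightOneSpectrum (𝓞 ℚ), localEulerPoincareCharacteristic (v.adicCompletion ℚ))
    (hG1 :     ∀ (W : WeierstrassCurve ℚ) [W.IsElliptic] [W.IsGloballyMinimal] (p : ℕ) [Fact p.Prime]
      (κ : ZpExtension ℚ p) (γ : absoluteGaloisGroup ℚ),
      p ≠ 2 → W.HasIrreducibleModPGaloisRep p → ¬ W.HasSurjectiveModNGaloisRep p →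
      κ.IsCyclotomic → κ.IsTopGenerator γ →
      (∀ v : HeightOneSpectrum (𝓞 ℚ), localEulerPoincareCharacteristic (v.adicCompletion ℚ)) →
      poitouTate_sum_localTatePairing_eq_zero ℚ →
      ∀ (S₀ : Set (HeightOneSpectrum (𝓞 ℚ))), S₀.Finite →
      ∃ (ε : ℕ) (S : Set (HeightOneSpectrum (𝓞 ℚ))), S.Finite ∧ S₀ ⊆ S ∧
        ∀ (J : ℕ) (y : Literature.NumberTheory.EllipticCurves.subgroupH1 κ.kerSubgroup
            (WeierstrassCurve.geomTorsion W (p : ℤ))),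
          W.torsionToPrimaryH1Sub p κ.kerSubgroup y ∈ W.fineSelmerInfty κ →
          (⇑(Literature.NumberTheory.EllipticCurves.conjH1 κ.kerSubgroup
              (WeierstrassCurve.geomTorsion W (p : ℤ)) γ -
            AddMonoidHom.id (Literature.NumberTheory.EllipticCurves.subgroupH1 κ.kerSubgroup
              (WeierstrassCurve.geomTorsion W (p : ℤ)))))^[J] y ≠ 0 →
          ∃ Ψ : galoisCohomology (W.modPTwist p κ.invTwist (J + 1)) 1,
            (κ.invTwist.shiftH1 (W.torsionGaloisModule (p : ℤ))
                (fun P : WeierstrassCurve.geomTorsion W (p : ℤ) => AddSubgroup.torsionBy.nsmul P)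
                (J + 1))^[J] Ψ ≠ 0 ∧
            (∀ v : HeightOneSpectrum (𝓞 ℚ), v ∉ S →
              galoisCohomology.localization (W.modPTwist p κ.invTwist (J + 1)) (Sum.inr v) 1 Ψ ∈
                DiscreteGaloisModule.unramifiedSubgroup
                  (GaloisRep.toLocal v (W.modPTwist p κ.invTwist (J + 1))) 1) ∧
            (∀ v : HeightOneSpectrum (𝓞 ℚ), v ∈ S →
              galoisCohomology.localization (W.modPTwist p κ.invTwist (J + 1)) (Sum.inr v) 1
                ((κ.invTwist.shiftH1 (W.torsionGaloisModule (p : ℤ))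
                  (fun P : WeierstrassCurve.geomTorsion W (p : ℤ) => AddSubgroup.torsionBy.nsmul P)
                  (J + 1))^[ε] Ψ) = 0))
    (hG34 :     ∀ (W : WeierstrassCurve ℚ) [W.IsElliptic] [W.IsGloballyMinimal] (p : ℕ) [Fact p.Prime]
      [ContinuousSMul ℤ_[p] (W.tateModule p)] [Module.Free ℤ_[p] (W.tateModule p)]
      [Module.Finite ℤ_[p] (W.tateModule p)]
      (κ : ZpExtension ℚ p) (γ : absoluteGaloisGroup ℚ) (I : IwasawaH1Data W p κ γ),
      p ≠ 2 → W.HasIrreducibleModPGaloisRep p → ¬ W.HasSurjectiveModNGaloisRep p →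
      κ.IsCyclotomic → κ.IsTopGenerator γ →
      poitouTate_sum_localTatePairing_eq_zero ℚ →
      ∀ (s : I.H), IsEulerSystemClass W p κ γ I s →
      ∃ (S₀ : Set (HeightOneSpectrum (𝓞 ℚ))), S₀.Finite ∧
        ∀ (a : ℕ) (κ' : κ.twistTower (W.torsionGaloisModule (p : ℤ))
            (fun P : WeierstrassCurve.geomTorsion W (p : ℤ) => AddSubgroup.torsionBy.nsmul P)),
          (κ.towerShift (W.torsionGaloisModule (p : ℤ))
              (fun P : WeierstrassCurve.geomTorsion W (p : ℤ) => AddSubgroup.torsionBy.nsmul P))^[a]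
            κ' = I.redTower s →
          ∀ (n e' : ℕ), e' + 1 = p ^ n →
          ∀ (Φ : contOneCocycles (W.modPTwist p κ (2 * e' + 1 + 1)).toTopRep),
            oneCocycleClass (W.modPTwist p κ (2 * e' + 1 + 1)).toTopRep Φ = κ'.1 (2 * e' + 1 + 1) →
          ∀ (ε : ℕ) (S₁ : Set (HeightOneSpectrum (𝓞 ℚ)))
            (Ψ : galoisCohomology (W.modPTwist p κ.invTwist (2 * e' + 1 + 1)) 1)
            (Ψc : contOneCocycles (W.modPTwist p κ.invTwist (2 * e' + 1 + 1)).toTopRep),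
            S₀ ⊆ S₁ →
            oneCocycleClass (W.modPTwist p κ.invTwist (2 * e' + 1 + 1)).toTopRep Ψc = Ψ →
            (∀ v : HeightOneSpectrum (𝓞 ℚ), v ∉ S₁ →
              galoisCohomology.localization (W.modPTwist p κ.invTwist (2 * e' + 1 + 1)) (Sum.inr v) 1
                  Ψ ∈
                DiscreteGaloisModule.unramifiedSubgroup
                  (GaloisRep.toLocal v (W.modPTwist p κ.invTwist (2 * e' + 1 + 1))) 1) →
            (∀ v : HeightOneSpectrum (𝓞 ℚ), v ∈ S₁ →
              galoisCohomology.localization (W.modPTwist p κ.invTwist (2 * e' + 1 + 1)) (Sum.inr v) 1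
                ((κ.invTwist.shiftH1 (W.torsionGaloisModule (p : ℤ))
                  (fun P : WeierstrassCurve.geomTorsion W (p : ℤ) => AddSubgroup.torsionBy.nsmul P)
                  (2 * e' + 1 + 1))^[ε] Ψ) = 0) →
          ∀ (eW : WeierstrassCurve.geomTorsion W (p : ℤ) → WeierstrassCurve.geomTorsion W (p : ℤ) →
              AlgebraicClosure ℚ)
            (hμ : ∀ S T, eW S T ^ p = 1)
            (hadd₁ : ∀ S₁' S₂' T, eW (S₁' + S₂') T = eW S₁' T * eW S₂' T)
            (hadd₂ : ∀ S T₁ T₂, eW S (T₁ + T₂) = eW S T₁ * eW S T₂),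
            (∀ T, eW T T = 1) → (∀ T, (∀ S, eW S T = 1) → T = 0) →
            (∀ (σ : absoluteGaloisGroup ℚ) (S T : WeierstrassCurve.geomTorsion W (p : ℤ)),
              σ • eW S T = eW (σ • S) (σ • T)) →
          ∀ (q : HeightOneSpectrum (𝓞 ℚ)), q ∉ S₁ →
          ∀ 𝔓 ∈ q.primesAbove, ∀ (Fr : absoluteGaloisGroup ℚ), IsArithFrobAt (𝓞 ℚ) Fr 𝔓 →
            WeierstrassCurve.galoisRepTorsion W p Fr = 1 →
            Fr ∈ κ.layerSubgroup n → Fr ∉ κ.layerSubgroup (n + 1) →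
          ∃ U : Polynomial ℤ, ¬ ((p : ℤ) ∣ U.coeff 0) ∧
            ∀ i : ℕ, i + ε < 2 * e' + 1 + 1 →
              convCoeff (weilPairingHom W p eW hμ hadd₁ hadd₂) (2 * e' + 1 + 1) i
                (Polynomial.aeval (shiftEnd (WeierstrassCurve.geomTorsion W (p : ℤ)) (2 * e' + 1 + 1)) U
                  ((shiftEnd (WeierstrassCurve.geomTorsion W (p : ℤ)) (2 * e' + 1 + 1) ^ (e' + 1 + a))
                    (Φ.1 Fr)))
                (Ψc.1 Fr) = 0) :
    CoreTheoremAOddPrime := by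
  intro W _ _ p _ _ _ _ κ γ I hp2 hgood hap hirr hns hκ hγ hs
  exact CoreAssembly.coreOdd_of_selmerDual_of_stepsTwoFour hred hPT hEP hG1 hG34 W p κ γ I hp2 hgood hap
    hirr hns hκ hγ hs

/-! With `hcore := coreTheoremAOddPrime_of_stubs hred hPT hEP hG1 hG34` the GEN 36/37 chain applies verbatim:
`coreTheoremAOnClassX10b_of_oddPrime hcore`, `katoMuTransferThree_of_coreOddPrime hne hfine hcore`
(N2's `μ`-transfer node modulo Kato's two construction facts), `mazurMainConjectureOnClassX10b_of_coreOddPrime …`,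
`bsdpOnClassX10b_of_coreOddPrime …` (the A5 class leaf) — no further wiring is needed. -/

end Summit.BirchSwinnertonDyer.Rank1Residual.X10

end
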